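import Mathlib
import Summits.NavierStokesRegularity.NavierStokesRegularity.Theorems.LevelSetModerationHighSpeedPressureWorkEarlyAnatomyTools
import Summits.NavierStokesRegularity.NavierStokesRegularity.Theorems.LevelSetModerationHighSpeedPressureWorkCruxAnatomy

/-!
# Route LevelSetModeration — `HighSpeedPressureWork`: pressure-free anatomy of the early bookkeeping

Support file for item stmt-NavierStokesRegularity-18149 (`HighSpeedPressureWork`), line
`line-iso-speed-area-closure` (skeleton v4, lead c1). By `…CruxAnatomy` the crux is
`UniformBound ∧ EarlyBookkeeping`, `EarlyBookkeeping` (= the registered stub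
`stub_earlyBookkeeping`) being the pairing law `PW_c(t) ≤ √(F V_c(T)) √(D_c(T))` in the early
window `t ≤ cₑν/B₀²` at the sharp levels `c ≥ B₀ = sup|u₀|` (margin zero). This file removes the
pressure from that residue. By the landed EXACT level-set balance
(`levelSetModeration_pressureFreeBalance`, Vasseur's Lemma 11 as an identity)

  `PW_c(t) = ½ ∫ (|u(t)| - c)₊² + ν ∫₀ᵗ∫ 1_{|u|>c} [ (c/|u|) |∇|u||² + (1 - c/|u|) |∇u|²_F ]`,

and all terms are nonnegative, so the early law for `PW` is equivalent to the conjunction of the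
same law for the SLICE TERM `U_c(t) = ½∫(|u(t)|-c)₊²` and for the VISCOUS TERM. The viscous
density splits as `|∇|u||² + (1 - c/|u|)(|∇u|²_F - |∇|u||²)` (Kato: `|∇|u|| ≤ |∇u|_F`); the first
part is `ν D_c(t)`, and seat 0's log-free fast-set law `ν² D_c(t) ≤ A² B₀⁴ V_c(t)`
(`levelSetModeration_fastSetDissipation_le`, margin zero, early window) gives
`ν D_c(t) ≤ A B₀² √(V_c(T)) √(D_c(T))` unconditionally. Hence

* `levelSetModeration_earlyBookkeeping_iff_slice_and_rotation`:
  `EarlyBookkeeping ↔ EarlySliceLaw ∧ EarlyRotationLaw`, where the ROTATION TERM is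
  `R_c(t) = ν ∫₀ᵗ∫ 1_{|u|>c} (1 - c/|u|)(|∇u|²_F - |∇|u||²) = ν ∫₀ᵗ∫ 1_{|u|>c} (1 - c/|u|) |u|² |∇û|²`
  (direction-gradient dissipation weighted by the overshoot);
* `levelSetModeration_highSpeedPressureWork_iff_uniformBound_slice_rotation`: the crux is
  `UniformBound ∧ EarlySliceLaw ∧ EarlyRotationLaw` — quantitative regularity of the class plus two
  PRESSURE-FREE laws at margin zero, each comparing a nonnegative functional of the speed with
  `√(V_c D_c)` in the window `t ≲ ν/B₀²`.

Heuristic status of the two residues (lead c1 notes, not used below): both hold with `F ∼ B₀⁴` on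
every mechanism examined (plateau flash, helical plateau under strain, blob-next-to-plateau,
nested shells with a threading jet); every chain of SUP bounds loses a factor `t_ν/τ` or
`log(t_ν/τ)` because `D_c` has no lower bound in terms of `V_c`; what is missing is a localisation
("pressure-drop budget along a fast component": acceleration × coherence length `≲ osc p̃ ≲ B₀²`).
-/

noncomputable section

-- single-conjunct summit: `Summit.<Summit>.<Problem>` repeats the name by the D-0017 layout
set_option linter.dupNamespace false

namespace Summit.NavierStokesRegularity.NavierStokesRegularity.Theorems

open MeasureTheory Set Filter Topology Function
open scoped ENNReal
open Literature.Analysis.FluidPDE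

/-! ### The laws: early bookkeeping ↔ slice law ∧ viscous law; viscous law ↔ rotation law -/

/-- **`EarlyBookkeeping ↔ EarlySliceLaw ∧ EarlyViscousLaw`.** The registered stub
`stub_earlyBookkeeping` (verbatim, left) holds iff both the slice term `½∫(|u(t)|-c)₊²` and the
viscous term of the exact balance obey the same early law `≤ √(F V_c(T)) √(D_c(T))`
(`PW = U + ν L`, all terms nonnegative; moduli add as `(√F₁⁺ + √F₂⁺)²`, windows intersect).
[folklore] -/
theorem levelSetModeration_earlyBookkeeping_iff_slice_and_viscous :
    (∃ cₑ : ℝ, 0 < cₑ ∧ ∀ (ν T : ℝ), 0 < ν → 0 < T → ∃ F : ℝ → ℝ → ℝ,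
        ∀ (u : ℝ → EuclideanSpace ℝ (Fin 3) → EuclideanSpace ℝ (Fin 3))
          (p : ℝ → EuclideanSpace ℝ (Fin 3) → ℝ),
          Literature.Analysis.FluidPDE.IsClassicalNSSolutionOn (Set.Ico 0 T) ν 0 u p →
          Literature.Analysis.FluidPDE.IsLerayHopfOn T ν 0 (u 0) u →
          Literature.Analysis.FluidPDE.HasRapidSpatialDecay (u 0) →
          ∀ (E₀ B₀ : ℝ), (∫ x, ‖u 0 x‖ ^ 2) ≤ E₀ → (∀ x, ‖u 0 x‖ ≤ B₀) →
          ∀ (M c t : ℝ), 2 * B₀ ≤ M → M / 2 ≤ c → c ≤ M → 0 < c → t ∈ Set.Ico 0 T →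
          t ≤ cₑ * ν / B₀ ^ 2 →
            -(∫ τ in Set.Ioo 0 t, ∫ x, max (1 - c / ‖u τ x‖) 0 *
              (fderiv ℝ (Literature.Analysis.FluidPDE.normalisedPressure (u τ)) x (u τ x))) ≤
            Real.sqrt (F E₀ B₀ * (∫⁻ τ in Set.Ioo 0 T, volume {x | c < ‖u τ x‖}).toReal) *
              Real.sqrt ((∫⁻ τ in Set.Ioo 0 T, ∫⁻ x, Set.indicator {x | c < ‖u τ x‖}
                (fun x => ENNReal.ofReal (‖fderiv ℝ (fun y => ‖u τ y‖) x‖ ^ 2)) x).toReal)) ↔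
    ((∃ cₑ : ℝ, 0 < cₑ ∧ ∀ (ν T : ℝ), 0 < ν → 0 < T → ∃ F : ℝ → ℝ → ℝ,
        ∀ (u : ℝ → EuclideanSpace ℝ (Fin 3) → EuclideanSpace ℝ (Fin 3))
          (p : ℝ → EuclideanSpace ℝ (Fin 3) → ℝ),
          Literature.Analysis.FluidPDE.IsClassicalNSSolutionOn (Set.Ico 0 T) ν 0 u p →
          Literature.Analysis.FluidPDE.IsLerayHopfOn T ν 0 (u 0) u →
          Literature.Analysis.FluidPDE.HasRapidSpatialDecay (u 0) →
          ∀ (E₀ B₀ : ℝ), (∫ x, ‖u 0 x‖ ^ 2) ≤ E₀ → (∀ x, ‖u 0 x‖ ≤ B₀) →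
          ∀ (M c t : ℝ), 2 * B₀ ≤ M → M / 2 ≤ c → c ≤ M → 0 < c → t ∈ Set.Ico 0 T →
          t ≤ cₑ * ν / B₀ ^ 2 →
            1 / 2 * (∫ x, (max (‖u t x‖ - c) 0) ^ 2) ≤
            Real.sqrt (F E₀ B₀ * (∫⁻ τ in Set.Ioo 0 T, volume {x | c < ‖u τ x‖}).toReal) *
              Real.sqrt ((∫⁻ τ in Set.Ioo 0 T, ∫⁻ x, Set.indicator {x | c < ‖u τ x‖}
                (fun x => ENNReal.ofReal (‖fderiv ℝ (fun y => ‖u τ y‖) x‖ ^ 2)) x).toReal)) ∧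
    (∃ cₑ : ℝ, 0 < cₑ ∧ ∀ (ν T : ℝ), 0 < ν → 0 < T → ∃ F : ℝ → ℝ → ℝ,
        ∀ (u : ℝ → EuclideanSpace ℝ (Fin 3) → EuclideanSpace ℝ (Fin 3))
          (p : ℝ → EuclideanSpace ℝ (Fin 3) → ℝ),
          Literature.Analysis.FluidPDE.IsClassicalNSSolutionOn (Set.Ico 0 T) ν 0 u p →
          Literature.Analysis.FluidPDE.IsLerayHopfOn T ν 0 (u 0) u →
          Literature.Analysis.FluidPDE.HasRapidSpatialDecay (u 0) →
          ∀ (E₀ B₀ : ℝ), (∫ x, ‖u 0 x‖ ^ 2) ≤ E₀ → (∀ x, ‖u 0 x‖ ≤ B₀) →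
          ∀ (M c t : ℝ), 2 * B₀ ≤ M → M / 2 ≤ c → c ≤ M → 0 < c → t ∈ Set.Ico 0 T →
          t ≤ cₑ * ν / B₀ ^ 2 →
            ν * (∫⁻ τ in Set.Ioo 0 t, ∫⁻ x, Set.indicator {x | c < ‖u τ x‖} (fun x => ENNReal.ofReal
              (c / ‖u τ x‖ * ‖fderiv ℝ (fun y => ‖u τ y‖) x‖ ^ 2 +
                (1 - c / ‖u τ x‖) *
                  Literature.Analysis.FluidPDE.frobeniusNormSq (fderiv ℝ (u τ) x))) x).toReal ≤
            Real.sqrt (F E₀ B₀ * (∫⁻ τ in Set.Ioo 0 T, volume {x | c < ‖u τ x‖}).toReal) *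
              Real.sqrt ((∫⁻ τ in Set.Ioo 0 T, ∫⁻ x, Set.indicator {x | c < ‖u τ x‖}
                (fun x => ENNReal.ofReal (‖fderiv ℝ (fun y => ‖u τ y‖) x‖ ^ 2)) x).toReal))) := by
  constructor
  · rintro ⟨cₑ, hcₑ, hE⟩
    refine ⟨⟨cₑ, hcₑ, fun ν T hν hT => ?_⟩, ⟨cₑ, hcₑ, fun ν T hν hT => ?_⟩⟩
    · obtain ⟨F, hF⟩ := hE ν T hν hT
      refine ⟨F, ?_⟩
      intro u p hcl hLH hdec E₀ B₀ hE0 hB0 M c t hM hMc hcM hc ht htw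
      have hPW := hF u p hcl hLH hdec E₀ B₀ hE0 hB0 M c t hM hMc hcM hc ht htw
      have hcB : ∀ x, ‖u 0 x‖ ≤ c := fun x => (hB0 x).trans (by linarith)
      obtain ⟨hbal, hU0, -, -⟩ := earlyAnatomy_terms hν hT hcl hLH hdec hc hcB ht
      rw [hbal] at hPW
      have hL0 : 0 ≤ ν * (∫⁻ τ in Set.Ioo 0 t, ∫⁻ x, Set.indicator {x | c < ‖u τ x‖}
          (fun x => ENNReal.ofReal (c / ‖u τ x‖ * ‖fderiv ℝ (fun y => ‖u τ y‖) x‖ ^ 2 +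
            (1 - c / ‖u τ x‖) * frobeniusNormSq (fderiv ℝ (u τ) x))) x).toReal :=
        mul_nonneg hν.le ENNReal.toReal_nonneg
      linarith
    · obtain ⟨F, hF⟩ := hE ν T hν hT
      refine ⟨F, ?_⟩
      intro u p hcl hLH hdec E₀ B₀ hE0 hB0 M c t hM hMc hcM hc ht htw
      have hPW := hF u p hcl hLH hdec E₀ B₀ hE0 hB0 M c t hM hMc hcM hc ht htw
      have hcB : ∀ x, ‖u 0 x‖ ≤ c := fun x => (hB0 x).trans (by linarith)
      obtain ⟨hbal, hU0, -, -⟩ := earlyAnatomy_terms hν hT hcl hLH hdec hc hcB ht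
      rw [hbal] at hPW
      linarith
  · rintro ⟨⟨c₁, hc₁, h₁⟩, ⟨c₂, hc₂, h₂⟩⟩
    refine ⟨min c₁ c₂, lt_min hc₁ hc₂, fun ν T hν hT => ?_⟩
    obtain ⟨F₁, hF₁⟩ := h₁ ν T hν hT
    obtain ⟨F₂, hF₂⟩ := h₂ ν T hν hT
    refine ⟨fun E₀ B₀ => (Real.sqrt (max (F₁ E₀ B₀) 0) + Real.sqrt (max (F₂ E₀ B₀) 0)) ^ 2, ?_⟩
    intro u p hcl hLH hdec E₀ B₀ hE0 hB0 M c t hM hMc hcM hc ht htw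
    obtain ⟨ht₁, ht₂⟩ := earlyAnatomy_window_min hν.le htw
    have hU := hF₁ u p hcl hLH hdec E₀ B₀ hE0 hB0 M c t hM hMc hcM hc ht ht₁
    have hVi := hF₂ u p hcl hLH hdec E₀ B₀ hE0 hB0 M c t hM hMc hcM hc ht ht₂
    have hcB : ∀ x, ‖u 0 x‖ ≤ c := fun x => (hB0 x).trans (by linarith)
    obtain ⟨hbal, -, -, -⟩ := earlyAnatomy_terms hν hT hcl hLH hdec hc hcB ht
    rw [hbal]
    exact earlyAnatomy_combine ENNReal.toReal_nonneg hU hVi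

/-- **`EarlyViscousLaw ↔ EarlyRotationLaw`.** The viscous term of the exact balance obeys the
early law iff its ROTATION part `ν∫₀ᵗ∫ 1_A (1-c/|u|)(|∇u|²_F - |∇|u||²)` does: the difference is
`ν D_c(t)`, bookkept unconditionally at margin zero by the log-free fast-set dissipation law
(`levelSetModeration_earlyDissipation_bookkept`, window `t ≤ εν/B₀²`); `R ≤ L` gives the converse.
[folklore] -/
theorem levelSetModeration_earlyViscous_iff_rotation :
    (∃ cₑ : ℝ, 0 < cₑ ∧ ∀ (ν T : ℝ), 0 < ν → 0 < T → ∃ F : ℝ → ℝ → ℝ,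
        ∀ (u : ℝ → EuclideanSpace ℝ (Fin 3) → EuclideanSpace ℝ (Fin 3))
          (p : ℝ → EuclideanSpace ℝ (Fin 3) → ℝ),
          Literature.Analysis.FluidPDE.IsClassicalNSSolutionOn (Set.Ico 0 T) ν 0 u p →
          Literature.Analysis.FluidPDE.IsLerayHopfOn T ν 0 (u 0) u →
          Literature.Analysis.FluidPDE.HasRapidSpatialDecay (u 0) →
          ∀ (E₀ B₀ : ℝ), (∫ x, ‖u 0 x‖ ^ 2) ≤ E₀ → (∀ x, ‖u 0 x‖ ≤ B₀) →
          ∀ (M c t : ℝ), 2 * B₀ ≤ M → M / 2 ≤ c → c ≤ M → 0 < c → t ∈ Set.Ico 0 T →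
          t ≤ cₑ * ν / B₀ ^ 2 →
            ν * (∫⁻ τ in Set.Ioo 0 t, ∫⁻ x, Set.indicator {x | c < ‖u τ x‖} (fun x => ENNReal.ofReal
              (c / ‖u τ x‖ * ‖fderiv ℝ (fun y => ‖u τ y‖) x‖ ^ 2 +
                (1 - c / ‖u τ x‖) *
                  Literature.Analysis.FluidPDE.frobeniusNormSq (fderiv ℝ (u τ) x))) x).toReal ≤
            Real.sqrt (F E₀ B₀ * (∫⁻ τ in Set.Ioo 0 T, volume {x | c < ‖u τ x‖}).toReal) *
              Real.sqrt ((∫⁻ τ in Set.Ioo 0 T, ∫⁻ x, Set.indicator {x | c < ‖u τ x‖}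
                (fun x => ENNReal.ofReal (‖fderiv ℝ (fun y => ‖u τ y‖) x‖ ^ 2)) x).toReal)) ↔
    (∃ cₑ : ℝ, 0 < cₑ ∧ ∀ (ν T : ℝ), 0 < ν → 0 < T → ∃ F : ℝ → ℝ → ℝ,
        ∀ (u : ℝ → EuclideanSpace ℝ (Fin 3) → EuclideanSpace ℝ (Fin 3))
          (p : ℝ → EuclideanSpace ℝ (Fin 3) → ℝ),
          Literature.Analysis.FluidPDE.IsClassicalNSSolutionOn (Set.Ico 0 T) ν 0 u p →
          Literature.Analysis.FluidPDE.IsLerayHopfOn T ν 0 (u 0) u →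
          Literature.Analysis.FluidPDE.HasRapidSpatialDecay (u 0) →
          ∀ (E₀ B₀ : ℝ), (∫ x, ‖u 0 x‖ ^ 2) ≤ E₀ → (∀ x, ‖u 0 x‖ ≤ B₀) →
          ∀ (M c t : ℝ), 2 * B₀ ≤ M → M / 2 ≤ c → c ≤ M → 0 < c → t ∈ Set.Ico 0 T →
          t ≤ cₑ * ν / B₀ ^ 2 →
            ν * (∫⁻ τ in Set.Ioo 0 t, ∫⁻ x, Set.indicator {x | c < ‖u τ x‖} (fun x => ENNReal.ofReal
              ((1 - c / ‖u τ x‖) *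
                (Literature.Analysis.FluidPDE.frobeniusNormSq (fderiv ℝ (u τ) x) -
                  ‖fderiv ℝ (fun y => ‖u τ y‖) x‖ ^ 2))) x).toReal ≤
            Real.sqrt (F E₀ B₀ * (∫⁻ τ in Set.Ioo 0 T, volume {x | c < ‖u τ x‖}).toReal) *
              Real.sqrt ((∫⁻ τ in Set.Ioo 0 T, ∫⁻ x, Set.indicator {x | c < ‖u τ x‖}
                (fun x => ENNReal.ofReal (‖fderiv ℝ (fun y => ‖u τ y‖) x‖ ^ 2)) x).toReal)) := by
  constructor
  · rintro ⟨cₑ, hcₑ, hE⟩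
    refine ⟨cₑ, hcₑ, fun ν T hν hT => ?_⟩
    obtain ⟨F, hF⟩ := hE ν T hν hT
    refine ⟨F, ?_⟩
    intro u p hcl hLH hdec E₀ B₀ hE0 hB0 M c t hM hMc hcM hc ht htw
    have hVi := hF u p hcl hLH hdec E₀ B₀ hE0 hB0 M c t hM hMc hcM hc ht htw
    have hcB : ∀ x, ‖u 0 x‖ ≤ c := fun x => (hB0 x).trans (by linarith)
    obtain ⟨-, -, hRL, hLfin⟩ := earlyAnatomy_terms hν hT hcl hLH hdec hc hcB ht
    exact (mul_le_mul_of_nonneg_left (ENNReal.toReal_mono hLfin hRL) hν.le).trans hVi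
  · rintro ⟨cR, hcR, hR⟩
    obtain ⟨A, ε, hA0, hε, hDlaw⟩ := levelSetModeration_earlyDissipation_bookkept
    refine ⟨min cR ε, lt_min hcR hε, fun ν T hν hT => ?_⟩
    obtain ⟨FR, hFR⟩ := hR ν T hν hT
    refine ⟨fun E₀ B₀ => (Real.sqrt (max ((A * B₀ ^ 2) ^ 2) 0) +
      Real.sqrt (max (FR E₀ B₀) 0)) ^ 2, ?_⟩
    intro u p hcl hLH hdec E₀ B₀ hE0 hB0 M c t hM hMc hcM hc ht htw
    obtain ⟨htR, htε⟩ := earlyAnatomy_window_min hν.le htw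
    have hRot := hFR u p hcl hLH hdec E₀ B₀ hE0 hB0 M c t hM hMc hcM hc ht htR
    rcases le_or_gt B₀ 0 with hB | hB
    · -- degenerate datum bound: the window is `t = 0` and the viscous term vanishes
      have ht0 : t = 0 := earlyAnatomy_eq_zero_of_nonpos hB hB0 ht htw
      subst ht0
      rw [earlyAnatomy_lintegral_Ioo_self, ENNReal.toReal_zero, mul_zero]
      positivity
    · -- `B₀ > 0`: split the viscous term and bookkeep the dissipation part
      have hcB₀ : B₀ ≤ c := by linarith
      have hcB : ∀ x, ‖u 0 x‖ ≤ c := fun x => (hB0 x).trans hcB₀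
      obtain ⟨-, -, hRL, hLfin⟩ := earlyAnatomy_terms hν hT hcl hLH hdec hc hcB ht
      have hD := hDlaw ν T u p hν hT hcl hLH hdec B₀ hB hB0 c t hcB₀ ht.2.le htε
      rw [earlyAnatomy_const_mul_sqrt (by positivity : 0 ≤ A * B₀ ^ 2)] at hD
      rw [earlyAnatomy_viscous_lintegral_eq hcl hc ht.2.le] at hLfin ⊢
      rw [ENNReal.toReal_add (ne_top_of_le_ne_top hLfin le_self_add)
        (ne_top_of_le_ne_top hLfin le_add_self), mul_add]
      exact earlyAnatomy_combine ENNReal.toReal_nonneg hD hRot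

/-- **`EarlyBookkeeping ↔ EarlySliceLaw ∧ EarlyRotationLaw`** — the pressure-free anatomy of
the registered stub `stub_earlyBookkeeping` (verbatim, left): the margin-zero pairing law in the
early window is exactly the conjunction of two pressure-free laws for nonnegative functionals of
the speed, the SLICE law for `½∫(|u(t)|-c)₊²` and the ROTATION law for
`ν∫₀ᵗ∫ 1_{|u|>c} (1-c/|u|) |u|²|∇û|²`. [folklore] -/
theorem levelSetModeration_earlyBookkeeping_iff_slice_and_rotation :
    (∃ cₑ : ℝ, 0 < cₑ ∧ ∀ (ν T : ℝ), 0 < ν → 0 < T → ∃ F : ℝ → ℝ → ℝ,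
        ∀ (u : ℝ → EuclideanSpace ℝ (Fin 3) → EuclideanSpace ℝ (Fin 3))
          (p : ℝ → EuclideanSpace ℝ (Fin 3) → ℝ),
          Literature.Analysis.FluidPDE.IsClassicalNSSolutionOn (Set.Ico 0 T) ν 0 u p →
          Literature.Analysis.FluidPDE.IsLerayHopfOn T ν 0 (u 0) u →
          Literature.Analysis.FluidPDE.HasRapidSpatialDecay (u 0) →
          ∀ (E₀ B₀ : ℝ), (∫ x, ‖u 0 x‖ ^ 2) ≤ E₀ → (∀ x, ‖u 0 x‖ ≤ B₀) →
          ∀ (M c t : ℝ), 2 * B₀ ≤ M → M / 2 ≤ c → c ≤ M → 0 < c → t ∈ Set.Ico 0 T →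
          t ≤ cₑ * ν / B₀ ^ 2 →
            -(∫ τ in Set.Ioo 0 t, ∫ x, max (1 - c / ‖u τ x‖) 0 *
              (fderiv ℝ (Literature.Analysis.FluidPDE.normalisedPressure (u τ)) x (u τ x))) ≤
            Real.sqrt (F E₀ B₀ * (∫⁻ τ in Set.Ioo 0 T, volume {x | c < ‖u τ x‖}).toReal) *
              Real.sqrt ((∫⁻ τ in Set.Ioo 0 T, ∫⁻ x, Set.indicator {x | c < ‖u τ x‖}
                (fun x => ENNReal.ofReal (‖fderiv ℝ (fun y => ‖u τ y‖) x‖ ^ 2)) x).toReal)) ↔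
    ((∃ cₑ : ℝ, 0 < cₑ ∧ ∀ (ν T : ℝ), 0 < ν → 0 < T → ∃ F : ℝ → ℝ → ℝ,
        ∀ (u : ℝ → EuclideanSpace ℝ (Fin 3) → EuclideanSpace ℝ (Fin 3))
          (p : ℝ → EuclideanSpace ℝ (Fin 3) → ℝ),
          Literature.Analysis.FluidPDE.IsClassicalNSSolutionOn (Set.Ico 0 T) ν 0 u p →
          Literature.Analysis.FluidPDE.IsLerayHopfOn T ν 0 (u 0) u →
          Literature.Analysis.FluidPDE.HasRapidSpatialDecay (u 0) →
          ∀ (E₀ B₀ : ℝ), (∫ x, ‖u 0 x‖ ^ 2) ≤ E₀ → (∀ x, ‖u 0 x‖ ≤ B₀) →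
          ∀ (M c t : ℝ), 2 * B₀ ≤ M → M / 2 ≤ c → c ≤ M → 0 < c → t ∈ Set.Ico 0 T →
          t ≤ cₑ * ν / B₀ ^ 2 →
            1 / 2 * (∫ x, (max (‖u t x‖ - c) 0) ^ 2) ≤
            Real.sqrt (F E₀ B₀ * (∫⁻ τ in Set.Ioo 0 T, volume {x | c < ‖u τ x‖}).toReal) *
              Real.sqrt ((∫⁻ τ in Set.Ioo 0 T, ∫⁻ x, Set.indicator {x | c < ‖u τ x‖}
                (fun x => ENNReal.ofReal (‖fderiv ℝ (fun y => ‖u τ y‖) x‖ ^ 2)) x).toReal)) ∧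
    (∃ cₑ : ℝ, 0 < cₑ ∧ ∀ (ν T : ℝ), 0 < ν → 0 < T → ∃ F : ℝ → ℝ → ℝ,
        ∀ (u : ℝ → EuclideanSpace ℝ (Fin 3) → EuclideanSpace ℝ (Fin 3))
          (p : ℝ → EuclideanSpace ℝ (Fin 3) → ℝ),
          Literature.Analysis.FluidPDE.IsClassicalNSSolutionOn (Set.Ico 0 T) ν 0 u p →
          Literature.Analysis.FluidPDE.IsLerayHopfOn T ν 0 (u 0) u →
          Literature.Analysis.FluidPDE.HasRapidSpatialDecay (u 0) →
          ∀ (E₀ B₀ : ℝ), (∫ x, ‖u 0 x‖ ^ 2) ≤ E₀ → (∀ x, ‖u 0 x‖ ≤ B₀) →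
          ∀ (M c t : ℝ), 2 * B₀ ≤ M → M / 2 ≤ c → c ≤ M → 0 < c → t ∈ Set.Ico 0 T →
          t ≤ cₑ * ν / B₀ ^ 2 →
            ν * (∫⁻ τ in Set.Ioo 0 t, ∫⁻ x, Set.indicator {x | c < ‖u τ x‖} (fun x => ENNReal.ofReal
              ((1 - c / ‖u τ x‖) *
                (Literature.Analysis.FluidPDE.frobeniusNormSq (fderiv ℝ (u τ) x) -
                  ‖fderiv ℝ (fun y => ‖u τ y‖) x‖ ^ 2))) x).toReal ≤
            Real.sqrt (F E₀ B₀ * (∫⁻ τ in Set.Ioo 0 T, volume {x | c < ‖u τ x‖}).toReal) *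
              Real.sqrt ((∫⁻ τ in Set.Ioo 0 T, ∫⁻ x, Set.indicator {x | c < ‖u τ x‖}
                (fun x => ENNReal.ofReal (‖fderiv ℝ (fun y => ‖u τ y‖) x‖ ^ 2)) x).toReal))) := by
  rw [levelSetModeration_earlyBookkeeping_iff_slice_and_viscous,
    levelSetModeration_earlyViscous_iff_rotation]

/-- **Anatomy of the crux, pressure-free form:**
`HighSpeedPressureWork ↔ UniformBound ∧ EarlySliceLaw ∧ EarlyRotationLaw` — the crux is
class-uniform quantitative regularity of the Schwartz-datum class (`UniformBound`, the open load
`stub_isoSpeedAreaLaw` of line `iso-speed-area-closure` up to the landed closure) plus two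
pressure-free laws at margin zero in the early window `t ≲ ν/B₀²`
(`levelSetModeration_highSpeedPressureWork_iff_uniformBound_and_early` composed with
`levelSetModeration_earlyBookkeeping_iff_slice_and_rotation`). [folklore] -/
theorem levelSetModeration_highSpeedPressureWork_iff_uniformBound_slice_rotation :
    Summit.NavierStokesRegularity.NavierStokesRegularity.Theses.LevelSetModeration.HighSpeedPressureWork ↔ ((∀ (ν T : ℝ), 0 < ν → 0 < T → ∀ (E₀ B₀ : ℝ), ∃ G : ℝ, ∀ (u : ℝ → EuclideanSpace ℝ (Fin 3) → EuclideanSpace ℝ (Fin 3)) (p : ℝ → EuclideanSpace ℝ (Fin 3) → ℝ), Literature.Analysis.FluidPDE.IsClassicalNSSolutionOn (Set.Ico 0 T) ν 0 u p → Literature.Analysis.FluidPDE.IsLerayHopfOn T ν 0 (u 0) u → Literature.Analysis.FluidPDE.HasRapidSpatialDecay (u 0) → (∫ x, ‖u 0 x‖ ^ 2) ≤ E₀ → (∀ x, ‖u 0 x‖ ≤ B₀) → ∀ t ∈ Set.Ico 0 T, ∀ x, ‖u t x‖ ≤ G) ∧ (∃ cₑ : ℝ, 0 < cₑ ∧ ∀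 (ν T : ℝ), 0 < ν → 0 < T → ∃ F : ℝ → ℝ → ℝ, ∀ (u : ℝ → EuclideanSpace ℝ (Fin 3) → EuclideanSpace ℝ (Fin 3)) (p : ℝ → EuclideanSpace ℝ (Fin 3) → ℝ), Literature.Analysis.FluidPDE.IsClassicalNSSolutionOn (Set.Ico 0 T) ν 0 u p → Literature.Analysis.FluidPDE.IsLerayHopfOn T ν 0 (u 0) u → Literature.Analysis.FluidPDE.HasRapidSpatialDecay (u 0) → ∀ (E₀ B₀ : ℝ), (∫ x, ‖u 0 x‖ ^ 2) ≤ E₀ → (∀ x, ‖u 0 x‖ ≤ B₀) → ∀ (M c t : ℝ), 2 * B₀ ≤ M → M / 2 ≤ c → c ≤ M → 0 < c → t ∈ Set.Ico 0 T → t ≤ cₑ * ν / B₀ ^ 2 → 1 / 2 * (∫ x, (max (‖u t x‖ - c) 0) ^ 2) ≤ Real.sqrt (F E₀ B₀ * (∫⁻ τ in Set.Ioo 0 T, MeasureTheory.volume {x | c < ‖u τ x‖}).toReal) * Real.sqrt ((∫⁻ τ in Set.Ioo 0 T, ∫⁻ x, Set.indicator {x | c < ‖u τ x‖} (fun x =>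 ENNReal.ofReal (‖fderiv ℝ (fun y => ‖u τ y‖) x‖ ^ 2)) x).toReal)) ∧ (∃ cₑ : ℝ, 0 < cₑ ∧ ∀ (ν T : ℝ), 0 < ν → 0 < T → ∃ F : ℝ → ℝ → ℝ, ∀ (u : ℝ → EuclideanSpace ℝ (Fin 3) → EuclideanSpace ℝ (Fin 3)) (p : ℝ → EuclideanSpace ℝ (Fin 3) → ℝ), Literature.Analysis.FluidPDE.IsClassicalNSSolutionOn (Set.Ico 0 T) ν 0 u p → Literature.Analysis.FluidPDE.IsLerayHopfOn T ν 0 (u 0) u → Literature.Analysis.FluidPDE.HasRapidSpatialDecay (u 0) → ∀ (E₀ B₀ : ℝ), (∫ x, ‖u 0 x‖ ^ 2) ≤ E₀ → (∀ x, ‖u 0 x‖ ≤ B₀) → ∀ (M c t : ℝ), 2 * B₀ ≤ M → M / 2 ≤ c → c ≤ M → 0 < c → t ∈ Set.Ico 0 T → t ≤ cₑ * ν / B₀ ^ 2 → ν * (∫⁻ τ in Set.Ioo 0 t, ∫⁻ x, Set.indicator {x | c < ‖u τ x‖} (fun x => ENNReal.ofReal ((1 - c / ‖u τ x‖) * (Literature.Analysis.FluidPDE.frobeniusNormSq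 (fderiv ℝ (u τ) x) - ‖fderiv ℝ (fun y => ‖u τ y‖) x‖ ^ 2))) x).toReal ≤ Real.sqrt (F E₀ B₀ * (∫⁻ τ in Set.Ioo 0 T, MeasureTheory.volume {x | c < ‖u τ x‖}).toReal) * Real.sqrt ((∫⁻ τ in Set.Ioo 0 T, ∫⁻ x, Set.indicator {x | c < ‖u τ x‖} (fun x => ENNReal.ofReal (‖fderiv ℝ (fun y => ‖u τ y‖) x‖ ^ 2)) x).toReal))) := by
  rw [levelSetModeration_highSpeedPressureWork_iff_uniformBound_and_early,
    levelSetModeration_earlyBookkeeping_iff_slice_and_rotation]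

end Summit.NavierStokesRegularity.NavierStokesRegularity.Theorems

end
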